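import Summits.AtomisticToContinuum.BoseEinsteinCondensation.Theses.BECStronglyRayleigh
import Literature.MathematicalPhysics.QuantumLattice.LiebMattisSectorPF

/-!
# Crux `GroundStateStability` (stmt-AtomisticToContinuum-9672) — load-bearing hypotheses

Crux-disprover results (route BECStronglyRayleigh, seat `refuter-cdisprove-stmt-AtomisticToContinuum-9672-0`).
Each theorem exhibits a kernel-checked witness showing that one hypothesis of the crux cannot be dropped:

* `groundStateStability_false_without_connected` — any proof must use `G.Connected`
  (two isolated sites: `H = 0`, the antisymmetric one-particle vector is a sector ground vector,
  polynomial `∝ z₀ - z₁`);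
* `groundStateStability_false_with_antiferro_sign` — any proof must use the ferromagnetic /
  bosonic sign `J = -1` (`GroundStateStabilityWithCoupling 1` fails on one bond at `Δ = 1`: the
  singlet is the sector ground vector by the tree's Marshall–Lieb–Mattis theorem);
* `groundStateStability_false_without_groundState` — "ground", not merely "eigen" (the singlet is
  an excited eigenvector of the ferromagnet);
* `groundStateStability_false_without_sector` — the magnetisation-sector restriction (one site,
  `H = 0`, the cross-sector superposition `|↑⟩ - i|↓⟩` has polynomial `z₀ - i`).

No matrix element is computed: the witnesses ride on `H = 0` or on `LiebMattis.sector_perronFrobenius`.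
All [folklore] (elementary witnesses).
-/

noncomputable section

namespace Summit.AtomisticToContinuum.BoseEinsteinCondensation.Theorems.GroundStateStability.Negative

open scoped BigOperators Matrix ComplexOrder
open Literature.MathematicalPhysics.QuantumLattice Matrix Complex

/-! ### The crux with the coupling sign as a parameter -/

/-- The crux statement with the XXZ coupling `J` exposed (`GroundStateStability` is `J = -1`, the
ferromagnetic-XY = hard-core-boson sign).
(statement only; not a literature fact) -/
def GroundStateStabilityWithCoupling (J : ℝ) : Prop :=
  ∀ (Λ : Type) [Fintype Λ] [DecidableEq Λ] (G : SimpleGraph Λ) [DecidableRel G.Adj], G.Connected →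
    ∀ (Δ : ℝ) (μ : Λ → ℝ), |Δ| ≤ 1 → ∀ (M : ℝ) (ψ : TensorIndex Λ 2 → ℂ), ψ ∈ spinZSector 1 M → ψ ≠ 0 →
      (xxzHamiltonian 1 G J Δ + ∑ x : Λ, ((μ x : ℝ) : ℂ) • siteSpin 1 x 2).mulVec ψ =
        ((lowestEnergyInSector 1 (xxzHamiltonian 1 G J Δ + ∑ x : Λ, ((μ x : ℝ) : ℂ) • siteSpin 1 x 2) M : ℝ) : ℂ) • ψ →
      ∀ z : Λ → ℂ, (∀ x, 0 < (z x).im) → (∑ S : Finset Λ, ψ (fun x => if x ∈ S then 0 else 1) * ∏ x ∈ S, z x) ≠ 0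

/-- `GroundStateStability` is literally the `J = -1` instance. [folklore] -/
theorem groundStateStabilityWithCoupling_neg_one_iff :
    GroundStateStabilityWithCoupling (-1) ↔
      Summit.AtomisticToContinuum.BoseEinsteinCondensation.Theses.BECStronglyRayleigh.GroundStateStability :=
  Iff.rfl

/-! ### Two identities between tree Hamiltonians -/

/-- At the isotropic point the XXZ Hamiltonian is the Heisenberg Hamiltonian:
`xxzHamiltonian n G J 1 = heisenbergHamiltonian n G J`. [folklore] -/
theorem xxzHamiltonian_one_eq_heisenberg {Λ : Type*} [Fintype Λ] [DecidableEq Λ] (n : ℕ)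
    (G : SimpleGraph Λ) [DecidableRel G.Adj] (J : ℝ) :
    xxzHamiltonian n G J 1 = heisenbergHamiltonian n G J := by
  unfold xxzHamiltonian heisenbergHamiltonian
  congr 1
  refine Finset.sum_congr rfl fun e _ => ?_
  induction e using Sym2.ind with
  | h x y => simp [spinDot, Fin.sum_univ_three]

/-- `heisenbergHamiltonian n G (-1) = -heisenbergHamiltonian n G 1` (ferro = minus antiferro). [folklore] -/
theorem heisenbergHamiltonian_neg_one {Λ : Type*} [Fintype Λ] [DecidableEq Λ] (n : ℕ)
    (G : SimpleGraph Λ) [DecidableRel G.Adj] :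
    heisenbergHamiltonian n G (-1) = -heisenbergHamiltonian n G 1 := by
  unfold heisenbergHamiltonian
  simp

/-! ### The two-site singlet witness -/

/-- **Two-site singlet.** On one bond (`Λ = Fin 2`, `G = ⊤`) the antiferromagnetic Heisenberg
Hamiltonian `heisenbergHamiltonian 1 ⊤ 1 = 𝐒₀·𝐒₁` has, in the sector of one up-spin, a ground vector `ψ`
(the singlet, obtained here abstractly from the tree's Marshall–Lieb–Mattis theorem, so no matrix element
is computed) whose occupation polynomial `ψ(↑↓) z₀ + ψ(↓↑) z₁` has the Marshall sign pattern `(+,-)` and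
hence a zero with `Im z₀, Im z₁ > 0`. [folklore] -/
theorem singlet_witness :
    ∃ ψ : TensorIndex (Fin 2) 2 → ℂ,
      ψ ∈ spinZSector 1 (((Fintype.card (Fin 2) * 1 : ℕ) : ℝ) / 2 - (1 : ℕ)) ∧ ψ ≠ 0 ∧
      heisenbergHamiltonian 1 (⊤ : SimpleGraph (Fin 2)) 1 *ᵥ ψ =
        ((lowestEnergyInSector 1 (heisenbergHamiltonian 1 (⊤ : SimpleGraph (Fin 2)) 1)
          (((Fintype.card (Fin 2) * 1 : ℕ) : ℝ) / 2 - (1 : ℕ)) : ℝ) : ℂ) • ψ ∧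
      ∃ z : Fin 2 → ℂ, (∀ x, 0 < (z x).im) ∧
        (∑ S : Finset (Fin 2), ψ (fun x => if x ∈ S then 0 else 1) * ∏ x ∈ S, z x) = 0 := by
  have hconn : (⊤ : SimpleGraph (Fin 2)).Connected := SimpleGraph.connected_top
  have hbip : (⊤ : SimpleGraph (Fin 2)).IsBipartiteWith ((({0} : Finset (Fin 2)) : Set (Fin 2)))
      ((({0} : Finset (Fin 2)) : Set (Fin 2)))ᶜ := by
    refine ⟨disjoint_compl_right, ?_⟩
    intro v w h
    fin_cases v <;> fin_cases w <;> simp_all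
  have hW : ∃ σ : TensorIndex (Fin 2) 2, (∑ z, (σ z : ℕ)) = 1 :=
    ⟨fun x => if x ∈ ({0} : Finset (Fin 2)) then 0 else 1, by decide⟩
  obtain ⟨⟨ψ, hψ, hψ0, hH⟩, -, -, hmarshall⟩ :=
    LiebMattis.sector_perronFrobenius 1 (⊤ : SimpleGraph (Fin 2)) 1 ({0} : Finset (Fin 2)) hconn hbip
      one_pos 1 hW
  obtain ⟨c, hc0, hsign⟩ := hmarshall ψ hψ hH hψ0
  refine ⟨ψ, hψ, hψ0, hH, ?_⟩
  -- the two weight-one configurations `↑↓ = 1_{ {0} }` and `↓↑ = 1_{ {1} }`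
  set σa : TensorIndex (Fin 2) 2 := fun x => if x ∈ ({0} : Finset (Fin 2)) then 0 else 1 with hσa
  set σb : TensorIndex (Fin 2) 2 := fun x => if x ∈ ({1} : Finset (Fin 2)) then 0 else 1 with hσb
  have hwa : (∑ z, (σa z : ℕ)) = 1 := by rw [hσa]; decide
  have hwb : (∑ z, (σb z : ℕ)) = 1 := by rw [hσb]; decide
  have hma : marshallSign ({0} : Finset (Fin 2)) σa = 1 := by
    have : ((σa 0 : Fin 2) : ℕ) = 0 := by rw [hσa]; decide
    simp [marshallSign, this]
  have hmb : marshallSign ({0} : Finset (Fin 2)) σb = -1 := by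
    have : ((σb 0 : Fin 2) : ℕ) = 1 := by rw [hσb]; decide
    simp [marshallSign, this]
  obtain ⟨ha_pos, ha_im⟩ := hsign σa hwa
  obtain ⟨hb_pos, hb_im⟩ := hsign σb hwb
  rw [hma] at ha_pos ha_im
  rw [hmb] at hb_pos hb_im
  -- the zero: z₀ = i·(-c ψ(↓↑)) , z₁ = i·(c ψ(↑↓)), both with positive imaginary part
  refine ⟨![I * (c * (-1) * ψ σb), I * (c * 1 * ψ σa)], ?_, ?_⟩
  · intro x
    fin_cases x
    · simpa using hb_pos
    · simpa using ha_pos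
  · -- only `S = {0}` and `S = {1}` contribute (sector support), and those two terms cancel
    have hw := (LiebMattis.mem_spinZSector_weight_iff 1 1 ψ).1 hψ
    have hvan : ∀ S : Finset (Fin 2), S ≠ {0} ∧ S ≠ {1} →
        ψ (fun x => if x ∈ S then 0 else 1) * ∏ x ∈ S, (![I * (c * (-1) * ψ σb), I * (c * 1 * ψ σa)] : Fin 2 → ℂ) x = 0 := by
      intro S hS
      have hS' : S = ∅ ∨ S = {0, 1} := by
        revert S
        decide
      rcases hS' with rfl | rfl
      · rw [hw _ (by decide), zero_mul]
      · rw [hw _ (by decide), zero_mul]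
    rw [Fintype.sum_eq_add ({0} : Finset (Fin 2)) {1} (by decide) hvan, Finset.prod_singleton,
      Finset.prod_singleton]
    simp only [Matrix.cons_val_zero, Matrix.cons_val_one]
    rw [← hσa, ← hσb]
    ring

/-! ### Load-bearing hypotheses -/

section LoadBearing

/-- The crux WITHOUT the hypothesis `G.Connected`.
(statement only; not a literature fact) -/
def GroundStateStabilityWithoutConnected : Prop :=
  ∀ (Λ : Type) [Fintype Λ] [DecidableEq Λ] (G : SimpleGraph Λ) [DecidableRel G.Adj],
    ∀ (Δ : ℝ) (μ : Λ → ℝ), |Δ| ≤ 1 → ∀ (M : ℝ) (ψ : TensorIndex Λ 2 → ℂ), ψ ∈ spinZSector 1 M → ψ ≠ 0 →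
      (xxzHamiltonian 1 G (-1) Δ + ∑ x : Λ, ((μ x : ℝ) : ℂ) • siteSpin 1 x 2).mulVec ψ =
        ((lowestEnergyInSector 1 (xxzHamiltonian 1 G (-1) Δ + ∑ x : Λ, ((μ x : ℝ) : ℂ) • siteSpin 1 x 2) M : ℝ) : ℂ) • ψ →
      ∀ z : Λ → ℂ, (∀ x, 0 < (z x).im) → (∑ S : Finset Λ, ψ (fun x => if x ∈ S then 0 else 1) * ∏ x ∈ S, z x) ≠ 0

/-- A sum over the edges of the empty graph vanishes (for ANY `Fintype` instance on its edge set —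
the instance hidden in `xxzHamiltonian 1 ⊥ J Δ` is not the canonical `fintypeEdgeSetBot`). [folklore] -/
theorem sum_edgeFinset_bot {V : Type*} {β : Type*} [AddCommMonoid β]
    [Fintype (⊥ : SimpleGraph V).edgeSet] (f : Sym2 V → β) :
    ∑ e ∈ (⊥ : SimpleGraph V).edgeFinset, f e = 0 := by
  refine Finset.sum_eq_zero fun e he => ?_
  rw [SimpleGraph.mem_edgeFinset, SimpleGraph.edgeSet_bot] at he
  exact absurd he (Set.notMem_empty e)

/-- The sector energy of the zero Hamiltonian is `0` (whether or not the sector is empty: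
`sInf ∅ = 0 = sInf {0}`). [folklore] -/
theorem lowestEnergyInSector_zero {Λ : Type*} [Fintype Λ] [DecidableEq Λ] (M : ℝ) :
    lowestEnergyInSector (Λ := Λ) 1 0 M = 0 := by
  unfold lowestEnergyInSector Matrix.minEnergyOn
  apply le_antisymm
  · apply Real.sInf_nonpos
    rintro E ⟨φ, -, -, rfl⟩
    simp
  · apply Real.sInf_nonneg
    rintro E ⟨φ, -, -, rfl⟩
    simp

/-- **Connectivity is load-bearing**: on two isolated sites (`G = ⊥`, `H = 0`) every sector vector
is a sector ground vector, in particular the antisymmetric one-particle vector, whose polynomial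
`∝ z₀ - z₁` vanishes at `z = (i, i)`-type points. Any proof of the crux must use `G.Connected`
(it enters through Perron–Frobenius uniqueness). [folklore] -/
theorem groundStateStability_false_without_connected : ¬ GroundStateStabilityWithoutConnected := by
  intro h
  obtain ⟨ψ, hψ, hψ0, -, z, hz, hzero⟩ := singlet_witness
  have hop0 : xxzHamiltonian 1 (⊥ : SimpleGraph (Fin 2)) (-1) 0 +
      ∑ x : Fin 2, (((fun _ : Fin 2 => (0 : ℝ)) x : ℝ) : ℂ) • siteSpin 1 x 2 = 0 := by
    simp [xxzHamiltonian, sum_edgeFinset_bot]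
  refine h (Fin 2) (⊥ : SimpleGraph (Fin 2)) 0 (fun _ => 0) (by norm_num) _ ψ hψ hψ0 ?_ z hz hzero
  rw [hop0, lowestEnergyInSector_zero]
  simp

/-- **The ferromagnetic (bosonic) sign is load-bearing**: with the antiferromagnetic sign `J = +1`
(one bond, `Δ = 1`, no field) the sector ground vector is the singlet, whose polynomial `∝ z₀ - z₁` has
zeros in `H²`. So no argument insensitive to the sign of the hopping can prove the crux; on bipartite
graphs the `J = +1` ground state is the Marshall-signed boson ground state, which is stable in the
mixed half-planes `(H)^A × (-H)^{Aᶜ}` instead. [folklore] -/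
theorem groundStateStability_false_with_antiferro_sign : ¬ GroundStateStabilityWithCoupling 1 := by
  intro h
  obtain ⟨ψ, hψ, hψ0, hH, z, hz, hzero⟩ := singlet_witness
  have hH0 : xxzHamiltonian 1 (⊤ : SimpleGraph (Fin 2)) 1 1 +
      ∑ x : Fin 2, (((fun _ : Fin 2 => (0 : ℝ)) x : ℝ) : ℂ) • siteSpin 1 x 2 =
      heisenbergHamiltonian 1 (⊤ : SimpleGraph (Fin 2)) 1 := by
    rw [xxzHamiltonian_one_eq_heisenberg]
    simp
  refine h (Fin 2) (⊤ : SimpleGraph (Fin 2)) SimpleGraph.connected_top 1 (fun _ => 0) (by norm_num) _ ψ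
    hψ hψ0 ?_ z hz hzero
  rw [hH0]
  exact hH

/-- The crux with "sector ground vector" weakened to "eigenvector of `H` lying in a sector".
(statement only; not a literature fact) -/
def GroundStateStabilityWithoutGroundState : Prop :=
  ∀ (Λ : Type) [Fintype Λ] [DecidableEq Λ] (G : SimpleGraph Λ) [DecidableRel G.Adj], G.Connected →
    ∀ (Δ : ℝ) (μ : Λ → ℝ), |Δ| ≤ 1 → ∀ (M : ℝ) (ψ : TensorIndex Λ 2 → ℂ), ψ ∈ spinZSector 1 M → ψ ≠ 0 →
      (∃ E : ℂ, (xxzHamiltonian 1 G (-1) Δ + ∑ x : Λ, ((μ x : ℝ) : ℂ) • siteSpin 1 x 2).mulVec ψ = E • ψ) →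
      ∀ z : Λ → ℂ, (∀ x, 0 < (z x).im) → (∑ S : Finset Λ, ψ (fun x => if x ∈ S then 0 else 1) * ∏ x ∈ S, z x) ≠ 0

/-- **"Ground" is load-bearing** (not merely "eigen"): the two-site singlet is an (excited)
eigenvector of the ferromagnet `xxzHamiltonian 1 ⊤ (-1) 1 = -𝐒₀·𝐒₁` in the one-particle sector, with
polynomial `∝ z₀ - z₁`. Stability is a property of the bottom of each sector only. [folklore] -/
theorem groundStateStability_false_without_groundState : ¬ GroundStateStabilityWithoutGroundState := by
  intro h
  obtain ⟨ψ, hψ, hψ0, hH, z, hz, hzero⟩ := singlet_witness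
  have hH0 : xxzHamiltonian 1 (⊤ : SimpleGraph (Fin 2)) (-1) 1 +
      ∑ x : Fin 2, (((fun _ : Fin 2 => (0 : ℝ)) x : ℝ) : ℂ) • siteSpin 1 x 2 =
      -heisenbergHamiltonian 1 (⊤ : SimpleGraph (Fin 2)) 1 := by
    rw [xxzHamiltonian_one_eq_heisenberg, heisenbergHamiltonian_neg_one]
    simp
  refine h (Fin 2) (⊤ : SimpleGraph (Fin 2)) SimpleGraph.connected_top 1 (fun _ => 0) (by norm_num) _ ψ
    hψ hψ0 ⟨-((lowestEnergyInSector 1 (heisenbergHamiltonian 1 (⊤ : SimpleGraph (Fin 2)) 1)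
          (((Fintype.card (Fin 2) * 1 : ℕ) : ℝ) / 2 - (1 : ℕ)) : ℝ) : ℂ), ?_⟩ z hz hzero
  rw [hH0, Matrix.neg_mulVec, hH, neg_smul]

/-- The crux with the magnetisation-sector restriction removed: `ψ` a GLOBAL ground vector of `H`
(`E` a lower bound of the quadratic form and `Hψ = Eψ`).
(statement only; not a literature fact) -/
def GroundStateStabilityWithoutSector : Prop :=
  ∀ (Λ : Type) [Fintype Λ] [DecidableEq Λ] (G : SimpleGraph Λ) [DecidableRel G.Adj], G.Connected →
    ∀ (Δ : ℝ) (μ : Λ → ℝ), |Δ| ≤ 1 → ∀ (E : ℝ) (ψ : TensorIndex Λ 2 → ℂ), ψ ≠ 0 →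
      (∀ φ : TensorIndex Λ 2 → ℂ, E * (star φ ⬝ᵥ φ).re ≤
        (star φ ⬝ᵥ (xxzHamiltonian 1 G (-1) Δ + ∑ x : Λ, ((μ x : ℝ) : ℂ) • siteSpin 1 x 2) *ᵥ φ).re) →
      (xxzHamiltonian 1 G (-1) Δ + ∑ x : Λ, ((μ x : ℝ) : ℂ) • siteSpin 1 x 2).mulVec ψ = (E : ℂ) • ψ →
      ∀ z : Λ → ℂ, (∀ x, 0 < (z x).im) → (∑ S : Finset Λ, ψ (fun x => if x ∈ S then 0 else 1) * ∏ x ∈ S, z x) ≠ 0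

/-- **The sector restriction is load-bearing**: on one site with no field (`H = 0`) the cross-sector
superposition `|↑⟩ - i|↓⟩` is a global ground vector with polynomial `z₀ - i`, vanishing at `z₀ = i`.
(This is why the route's target selects the sector with a penalty `4L³(S³_tot + L³/2 - N)²`.) [folklore] -/
theorem groundStateStability_false_without_sector : ¬ GroundStateStabilityWithoutSector := by
  intro h
  have hE : (⊤ : SimpleGraph (Fin 1)).edgeFinset = ∅ := by
    ext e
    induction e using Sym2.ind with
    | h x y =>
      simp only [SimpleGraph.mem_edgeFinset, SimpleGraph.mem_edgeSet, SimpleGraph.top_adj,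
        Finset.notMem_empty, iff_false, ne_eq, not_not]
      exact Subsingleton.elim x y
  have hop0 : xxzHamiltonian 1 (⊤ : SimpleGraph (Fin 1)) (-1) 0 +
      ∑ x : Fin 1, (((fun _ : Fin 1 => (0 : ℝ)) x : ℝ) : ℂ) • siteSpin 1 x 2 = 0 := by
    simp [xxzHamiltonian, hE]
  let ψ : TensorIndex (Fin 1) 2 → ℂ := fun σ => if σ 0 = 0 then 1 else -I
  have hψ0 : ψ ≠ 0 := by
    intro h0
    have := congrFun h0 (fun _ => 0)
    simp [ψ] at this
  refine h (Fin 1) (⊤ : SimpleGraph (Fin 1)) SimpleGraph.connected_top 0 (fun _ => 0) (by norm_num) 0 ψ hψ0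
    ?_ ?_ (fun _ => I) (fun _ => by simp) ?_
  · intro φ
    rw [hop0]
    simp
  · rw [hop0]
    simp
  · -- Σ_S ψ(1_S) ∏_{x∈S} i over S ∈ {∅, {0}} = (-i) + i = 0
    have hvan : ∀ S : Finset (Fin 1), S ≠ ∅ ∧ S ≠ {0} →
        ψ (fun x => if x ∈ S then 0 else 1) * ∏ x ∈ S, (fun _ : Fin 1 => I) x = 0 := by
      intro S hS
      exfalso
      have : S = ∅ ∨ S = {0} := by
        revert S
        decide
      tauto
    rw [Fintype.sum_eq_add (∅ : Finset (Fin 1)) {0} (by decide) hvan, Finset.prod_empty,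
      Finset.prod_singleton]
    simp [ψ]

end LoadBearing

end Summit.AtomisticToContinuum.BoseEinsteinCondensation.Theorems.GroundStateStability.Negative
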